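import Literature.AlgebraicGeometry.Modules.TensorSheafHomIso
import Literature.AlgebraicGeometry.Modules.LocallyFreeTrace
import Literature.AlgebraicGeometry.Modules.DetClassDual
import HarnessLib

/-!
# `L ⊗ –` is an equivalence of `Mod(𝒪_X)` for `L` locally free of rank one (The Stacks Project, Tag 0B8M)

Layer `Literature/AlgebraicGeometry/Modules`, namespace `Literature.AlgebraicGeometry.Modules`.
THEOREMS plus natural-isomorphism plumbing; no named fact, no instance, no notation. This file is the
discharge road of the named fact `Modules.LocallyFreeRankOneIsInvertible` (`Modules/InvertibleModule`,
Stacks 0B8M first sentence: "Any locally free `𝒪_X`-module of rank `1` is invertible", i.e.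
`𝓕 ↦ 𝓛 ⊗ 𝓕` is an equivalence, Definition 17.25.1 = Tag 01CS); the one-line discharge
`LocallyFreeRankOneIsInvertible_holds` is appended to that file.

ROAD (associator-free). Stacks' proof uses the evaluation isomorphism `𝓛 ⊗ 𝓛^∨ ≅ 𝒪_X` and the
associativity of `⊗` (quasi-inverse `𝓛^∨ ⊗ –`, Lemma 17.25.2 = Tag 0B8K). The tree's sheafified
`Modules.tensorObj` has no associator; instead we go through the internal-Hom model:

* §1 the contraction `c_G : 𝓗om(E, 𝓗om(E^∨, G)) ⟶ G` of a finite locally free `E`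
  (`Modules/LocallyFreeTrace.contract`, Hartshorne II Ex. 5.1 (b)) is NATURAL in `G`
  (`frameContract_naturality`, `contract_naturality`, `contractNatTrans`);
* §2 for `E` of RANK ONE it is an ISOMORPHISM (`isIso_contract_of_hasRank_one`: below a rank-one frame
  `b`, `λ` it reads `B ↦ B(b)(λ)`, a composite of two "value on the basis" bijections,
  `appLE_basisSection_bijective_of_unique`), whence `contractNatIso : 𝓗om(E^∨, –) ⋙ 𝓗om(E, –) ≅ 𝟭`;
* §3 **`isEquivalence_tensorBifunctor_obj_of_hasRank_one`**: for `L` finite locally free of rank one,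
  `F := L ⊗ –` has the left quasi-inverse `G := 𝓗om(L, –)` —
  `F ⋙ G = 𝓗om(L, L ⊗ –) ≅ 𝓗om(L, 𝓗om(L^∨, –)) ≅ 𝟭` (`Modules/TensorSheafHomIso.tensorSheafHomDualNatIso`,
  then §2 for `L`) — and the right quasi-inverse `G' := L^∨ ⊗ –` —
  `G' ⋙ F = L ⊗ (L^∨ ⊗ –) ≅ 𝓗om(L^∨, L^∨ ⊗ –) ≅ 𝓗om(L^∨, 𝓗om(L^∨∨, –)) ≅ 𝟭` (the same two lemmas
  for `L` and for `L^∨`, which is again locally free of rank one, `Modules/DetClassDual.hasRank_dual`);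
  a functor with quasi-inverses on both sides is an equivalence (`G ≅ G'` by the usual argument,
  `isoOfQuasiInverses`), so `F.IsEquivalence` (Mathlib `CategoryTheory.Equivalence.mk`).

## References

* The Stacks Project, Tag 0B8M (Modules, Lemma 17.25.4), Tag 01CS (Definition 17.25.1), Tag 0B8K.
  [StacksProject]
* R. Hartshorne, *Algebraic Geometry*, GTM 52 (1977), II Ex. 5.1 (b) (p. 123), II Prop. 6.12 (p. 143).
  [Hartshorne1977]
-/

noncomputable section

-- `TopCat.Presheaf`/`Scheme.Modules` are not reducible (as in Mathlib's `AlgebraicGeometry/Modules/Sheaf.lean`).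
set_option backward.isDefEq.respectTransparency false

open CategoryTheory AlgebraicGeometry Opposite TopologicalSpace MonoidalCategory
open Literature.AlgebraicGeometry.Motives
open Literature.AlgebraicGeometry.FormalGeometry.WittGrothendieckExistence.FormalVectorBundlesAlgebraize

universe u

namespace Literature.AlgebraicGeometry.Modules

variable {X : Scheme.{u}}

/-! ### §1 The contraction `𝓗om(E, 𝓗om(E^∨, G)) ⟶ G` is natural in `G` -/

section Naturality

variable {E G G' : X.Modules} {W : X.Opens} {I : Type u} [Fintype I]

/-- The contraction in a frame is natural in `G`: `∑ (B ≫ 𝓗om(E^∨, g))(b_i)(λ_i) = g(∑ B(b_i)(λ_i))`.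
[cite: Hartshorne1977, II Ex. 5.1 (b)] -/
theorem frameContract_naturality (e : SheafOfModules.free I ≅ E.over W) (g : G ⟶ G')
    (B : E.over W ⟶ (sheafHom (dual E) G).over W) :
    frameContract G' e (B ≫ (SheafOfModules.overFunctor _ W).map (sheafHomMap (dual E) g)) =
      g.app W (frameContract G e B) := by
  unfold frameContract
  rw [map_sum]
  refine Finset.sum_congr rfl fun i _ => ?_
  rw [appLE_comp_over_map, sheafHomMap_app_apply, appLE_comp_over_map]

variable (hE : IsFiniteLocallyFree E)
include hE

/-- **The contraction `𝓗om(E, 𝓗om(E^∨, G)) ⟶ G` is natural in `G`**: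
`𝓗om(E, 𝓗om(E^∨, g)) ≫ c_{G'} = c_G ≫ g` (check on the framed cover defining the contraction values).
[cite: Hartshorne1977, II Ex. 5.1 (b)] -/
theorem contract_naturality (g : G ⟶ G') :
    sheafHomMap E (sheafHomMap (dual E) g) ≫ contract hE G' = contract hE G ≫ g := by
  apply Scheme.Modules.hom_ext
  intro U
  ext B
  change (contract hE G').app U ((sheafHomMap E (sheafHomMap (dual E) g)).app U B) =
    g.app U ((contract hE G).app U B)
  rw [sheafHomMap_app_apply, contract_app_apply, contract_app_apply]
  symm
  refine eq_contractValue hE G' U _ fun x => ?_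
  rw [← app_presheaf_map g, map_contractValue_piece, contractPieces, contractPieces, restrictHom_comp,
    restrictHom_over_map, frameContract_naturality]

variable (E) in
/-- The contraction as a natural transformation `𝓗om(E^∨, –) ⋙ 𝓗om(E, –) ⟶ 𝟭` of endofunctors of
`Mod(𝒪_X)`. [cite: Hartshorne1977, II Ex. 5.1 (b)] -/
def contractNatTrans : sheafHomFunctor (dual E) ⋙ sheafHomFunctor E ⟶ 𝟭 X.Modules where
  app G := contract hE G
  naturality _ _ g := contract_naturality hE g

/-- Components of `contractNatTrans`. [cite: Hartshorne1977, II Ex. 5.1 (b)] -/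
@[simp]
theorem contractNatTrans_app (G : X.Modules) : (contractNatTrans E hE).app G = contract hE G := rfl

end Naturality

/-! ### §2 In rank one the contraction is an isomorphism -/

section RankOne

variable {E M : X.Modules} {W : X.Opens} {I : Type u}

/-- **A morphism out of a free module of rank one is its value on the basis section**: for a
trivialisation `e : 𝒪^I ≅ E|_W` with `I` a one-element type, `B ↦ B(b)` is a bijection
`Hom(E|_W, M|_W) ≃ Γ(M, W)` (inverse `homOfBasisValues`). [cite: Hartshorne1977, II.5 p. 109 (free sheaves)] -/
theorem appLE_basisSection_bijective_of_unique [Unique I] (e : SheafOfModules.free I ≅ E.over W) :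
    Function.Bijective fun B : E.over W ⟶ M.over W => appLE B (𝟙 W) (basisSection e default) := by
  refine ⟨fun B B' h => hom_ext_of_basisSection e fun i => ?_, fun m => ⟨homOfBasisValues e fun _ => m, ?_⟩⟩
  · rw [Unique.eq_default i]; exact h
  · exact appLE_homOfBasisValues e _ default

variable (hE : IsFiniteLocallyFree E) (G : X.Modules)

/-- **Below a rank-one frame the contraction is `B ↦ B(b)(λ)`, a bijection** (`b` the basis section,
`λ` the dual basis section). [cite: Hartshorne1977, II Ex. 5.1 (b)] -/
theorem contract_app_bijective_of_unique [Unique I] (e : SheafOfModules.free I ≅ E.over W) :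
    Function.Bijective ((contract hE G).app W) := by
  haveI : Fintype I := Fintype.ofFinite I
  have h : ⇑(ConcreteCategory.hom ((contract hE G).app W)) =
      (fun Φ : (dual E).over W ⟶ G.over W => appLE Φ (𝟙 W) (basisSection (dualFrame e) default)) ∘
        fun B : E.over W ⟶ (sheafHom (dual E) G).over W =>
          ((appLE B (𝟙 W) (basisSection e default) : Γ(sheafHom (dual E) G, W)) :
            (dual E).over W ⟶ G.over W) := by
    funext B
    change (contract hE G).app W B = _
    rw [contract_app_eq_frameContract hE G e, frameContract, Finset.univ_unique, Finset.sum_singleton,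
      Function.comp_apply, basisSection_dualFrame]
  rw [h]
  exact (appLE_basisSection_bijective_of_unique (M := G) (dualFrame e)).comp
    (appLE_basisSection_bijective_of_unique (M := sheafHom (dual E) G) e)

/-- **The contraction `𝓗om(E, 𝓗om(E^∨, G)) ⟶ G` is an isomorphism for `E` locally free of rank one**
(isomorphisms of `𝒪_X`-modules are local; below a rank-one frame the contraction is `B ↦ B(b)(λ)`).
[cite: Hartshorne1977, II Ex. 5.1 (b)] -/
theorem isIso_contract_of_hasRank_one (h₁ : HasRank E 1) : IsIso (contract hE G) := by
  refine PushforwardTransport.isIso_of_nhds_bijective _ fun x => ?_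
  obtain ⟨F, hF⟩ := exists_frameSystem_of_hasRank h₁
  haveI : Unique (F.I x) := ((F.enum x).trans (finCongr (hF x))).unique
  refine ⟨F.U x, F.mem x, fun V hV => ?_⟩
  exact contract_app_bijective_of_unique hE G
    (SheafOfModules.restrictTrivialisation (R := X.ringCatSheaf) (homOfLE hV) (F.frame x))

variable (E) in
/-- **`𝓗om(E^∨, –) ⋙ 𝓗om(E, –) ≅ 𝟭`** for `E` locally free of rank one: the contraction, componentwise
an isomorphism. [cite: Hartshorne1977, II Ex. 5.1 (b)] -/
def contractNatIso (h₁ : HasRank E 1) : sheafHomFunctor (dual E) ⋙ sheafHomFunctor E ≅ 𝟭 X.Modules :=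
  haveI : ∀ G : X.Modules, IsIso ((contractNatTrans E hE).app G) := fun G =>
    isIso_contract_of_hasRank_one hE G h₁
  haveI : IsIso (contractNatTrans E hE) := NatIso.isIso_of_isIso_app _
  asIso (contractNatTrans E hE)

/-- Components of `contractNatIso`. [cite: Hartshorne1977, II Ex. 5.1 (b)] -/
@[simp]
theorem contractNatIso_hom_app (h₁ : HasRank E 1) (G : X.Modules) :
    (contractNatIso E hE h₁).hom.app G = contract hE G := rfl

end RankOne

/-! ### §3 `L ⊗ –` is an equivalence for `L` locally free of rank one (Stacks 0B8M) -/

section Equivalence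

variable {C : Type*} [Category C]

/-- A functor with a left quasi-inverse `G` (`F ⋙ G ≅ 𝟭`) and a right quasi-inverse `G'`
(`G' ⋙ F ≅ 𝟭`) has `G ≅ G'` (`G' ≅ G' ⋙ (F ⋙ G) = (G' ⋙ F) ⋙ G ≅ G`). [folklore] -/
private def isoOfQuasiInverses {F G G' : C ⥤ C} (u : F ⋙ G ≅ 𝟭 C) (c : G' ⋙ F ≅ 𝟭 C) : G' ≅ G :=
  G'.rightUnitor.symm ≪≫ Functor.isoWhiskerLeft G' u.symm ≪≫ (Functor.associator G' F G).symm ≪≫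
    Functor.isoWhiskerRight c G ≪≫ G.leftUnitor

/-- Hence such a functor is an equivalence (its left quasi-inverse is also a right quasi-inverse).
[folklore] -/
private theorem isEquivalence_of_quasiInverses {F G G' : C ⥤ C} (u : F ⋙ G ≅ 𝟭 C) (c : G' ⋙ F ≅ 𝟭 C) :
    F.IsEquivalence :=
  (CategoryTheory.Equivalence.mk F G u.symm (Functor.isoWhiskerRight (isoOfQuasiInverses u c).symm F ≪≫ c)).isEquivalence_functor

variable {L : X.Modules}

/-- **`L ⊗ –` is an equivalence of `Mod(𝒪_X)` for `L` finite locally free of rank one** (The Stacks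
Project, Lemma 17.25.4 = Tag 0B8M, first sentence, for the tree's `Modules.tensorBifunctor`): left
quasi-inverse `𝓗om(L, –)` via `𝓗om(L, L ⊗ –) ≅ 𝓗om(L, 𝓗om(L^∨, –)) ≅ 𝟭`, right quasi-inverse `L^∨ ⊗ –`
via `L ⊗ (L^∨ ⊗ –) ≅ 𝓗om(L^∨, 𝓗om(L^∨∨, –)) ≅ 𝟭` (`L ⊗ E ≅ 𝓗om(L^∨, E)`, Hartshorne II Ex. 5.1 (b),
and the rank-one contraction). [cite: StacksProject, Tag 0B8M (Modules, Lemma 17.25.4)]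
[cite: Hartshorne1977, II Ex. 5.1 (b) (p. 123)] -/
theorem isEquivalence_tensorBifunctor_obj_of_hasRank_one (hL : IsFiniteLocallyFree L) (h₁ : HasRank L 1) :
    ((tensorBifunctor X).obj L).IsEquivalence := by
  have hL' : IsFiniteLocallyFree (dual L) := isFiniteLocallyFree_dual hL
  have h₁' : HasRank (dual L) 1 := hasRank_dual h₁
  -- left quasi-inverse `𝓗om(L, –)`
  let u : (tensorBifunctor X).obj L ⋙ sheafHomFunctor L ≅ 𝟭 X.Modules :=
    Functor.isoWhiskerRight (tensorSheafHomDualNatIso L hL) (sheafHomFunctor L) ≪≫ contractNatIso L hL h₁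
  -- right quasi-inverse `L^∨ ⊗ –`
  let c : (tensorBifunctor X).obj (dual L) ⋙ (tensorBifunctor X).obj L ≅ 𝟭 X.Modules :=
    Functor.isoWhiskerLeft ((tensorBifunctor X).obj (dual L)) (tensorSheafHomDualNatIso L hL) ≪≫
      Functor.isoWhiskerRight (tensorSheafHomDualNatIso (dual L) hL') (sheafHomFunctor (dual L)) ≪≫
        contractNatIso (dual L) hL' h₁'
  exact isEquivalence_of_quasiInverses u c

end Equivalence

end Literature.AlgebraicGeometry.Modules

end
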